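import Literature.AlgebraicGeometry.Motives.FaltingsECCardFactsProofs
import Literature.AlgebraicGeometry.Motives.FaltingsECOfAbelianVarietyLatticeProofs
import Literature.NumberTheory.EllipticCurves.IsogenyDualFiniteFieldProofs
import Literature.AlgebraicGeometry.Motives.FaltingsECTateFiniteNamedFactsProofs
import Literature.NumberTheory.EllipticCurves.AbelianVarietyBridgeProofs
import Literature.AlgebraicGeometry.Motives.TateAbelianFiniteLatticeProofs
import HarnessLib

/-!
# Tate's isogeny theorem `E ~ E' ↔ #E(k) = #E'(k)`: the current frontier, machine-checked

Sibling proof file of `Literature.AlgebraicGeometry.Motives.FaltingsEC` (D-0014: theorems only,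
no definitions) for the named fact

* `Literature.AlgebraicGeometry.Motives.isIsogenous_iff_card_point_eq W W'` — two elliptic curves
  over a finite field `k` are isogenous over `k` iff `#E(k) = #E'(k)` (J. Tate, Invent. Math. 2
  (1966), §3, Theorem 1, specialised to elliptic curves, where `f_E = T² - aT + q` is determined by
  `#E(k) = q + 1 - a`; Silverman, *AEC*, 2nd ed., Exercise 5.4).

It records, as one theorem, **exactly what separates the tree from
`isIsogenous_iff_card_point_eq_holds`** after the work of `FaltingsECCardProofs`,
`FaltingsECCardFactsProofs` (the `ℓ`-adic assembly; direction `→` and Thm. V.2.3.1 proved),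
`FaltingsECTateFiniteHoldsProofs` (Tate's Main Theorem in `End` form proved),
`TateAbelianFiniteLattice` (Tate's lattice lemma for abelian varieties over finite fields proved
from the finiteness of isomorphism classes) and `FaltingsECOfAbelianVarietyLatticeProofs` (the
transport `E × E' ↝ (E, E')`): the point-count fact follows from six named facts of the tree,
none of them specific to Tate's paper —

1. `WeierstrassCurve.nonempty_abelianVarietyBridge_symm W W'` — elliptic curves are abelian
   varieties of dimension one, for both orders of the pair (*AEC* III.3.1(c), III.3.6, III.4.8);
2. `AbelianVariety.hasBinaryBiproduct A A'` for all abelian varieties `A, A'` over `K` — products;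
3. `AbelianVariety.finite_isoClasses_of_finite K g` for all `g` — finitely many `K`-isomorphism
   classes of `g`-dimensional abelian varieties over a finite field (Milne 1986, Cor. 18.9);
4. `AbelianVariety.exists_quotient_isogeny P ℓ` for all `P` — quotients by finite `Γ_K`-stable
   subgroups with the factorisation of `[ℓⁿ]` (Mumford §7 Thm. 4; Kieffer 2024, Prop. 1.1.10–13);
5. `AbelianVariety.natCard_torsionPoints_of_isAlgClosed P K̄` for all `P` — `#P[n](K̄) = n^{2g}`
   (Mumford §6);
6. `WeierstrassCurve.Isogeny.nonempty_symm` for `(E', E)` — the dual isogeny (*AEC* III.6.1); the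
   tree proves it for separable isogenies (`Isogeny.nonempty_symm_of_deg_le_card_ker`) and in
   characteristic `0` (`Isogeny.nonempty_symm_of_charZero`), not yet for inseparable ones.

Items 2–5 are the theory of abelian varieties (trunk `abelian_variety`); item 1 is the
identification of a smooth Weierstrass cubic with a one-dimensional abelian variety; item 6 is
the only input at the level of Weierstrass curves. The direction `→` of the fact is the tree's
unconditional `card_point_eq_of_isIsogenous`; the hypotheses serve `←` only, through Tate's
existence statement "(b) ⇒ (a)" of Theorem 1 (a non-zero `Γ_k`-map `T_ℓ E → T_ℓ E'` comes from
an isogeny), whose printed proof is the Main Theorem for the abelian surface `E × E'`.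

## Contents

* `isIsogenous_iff_card_point_eq_of_named_facts` — the fact from the six named facts, the
  quotient fact being needed at one prime `ℓ` invertible in `k`;
* `isIsogenous_iff_card_point_eq_of_named_facts_forall` — the same with the quotient fact at
  every prime (a prime `ℓ ∈ {2, 3}` invertible in `k` exists, `exists_prime_natCast_ne_zero`):
  the literal shape of the eventual `isIsogenous_iff_card_point_eq_holds`.

## References

* [Tate1966Endomorphisms] J. Tate, *Endomorphisms of abelian varieties over finite fields*,
  Invent. Math. 2 (1966), 134–144: Main Theorem; §2; §3 Theorem 1.
* [SilvermanAEC2009] J. H. Silverman, *The Arithmetic of Elliptic Curves*, 2nd ed., GTM 106: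
  Exercise 5.4, Thm. III.7.7(a), Thm. III.6.1, III.3.1(c), III.3.6, III.4.8.
* [Milne1986AbelianVarieties] J. S. Milne, *Abelian Varieties* (Cornell–Silverman 1986), Cor. 18.9.
* [MumfordAV1970] D. Mumford, *Abelian Varieties* (1970), §6, §7.
* [Kieffer2024IsogenyGraphs] J. Kieffer, *Isogeny graphs of abelian varieties over finite fields*
  (2024), §1.1–1.2.

## Design

`noncomputable section`, `namespace Literature.AlgebraicGeometry.Motives` (path-aligned), base
field `K : Type u`; theorems only, each a composition of theorems of the two imported files
(`isIsogenous_iff_card_point_eq_of_isogenyTheorem`,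
`isIsogenous_of_finite_iff_exists_tateModule_hom_ne_zero_of_named_facts`).
-/

noncomputable section

universe u

namespace Literature.AlgebraicGeometry.Motives

open WeierstrassCurve AbelianVariety

variable {K : Type u} [Field K] (W W' : WeierstrassCurve K)

/-- **Tate's isogeny theorem in point-count form, from the six named facts** (one prime `ℓ`
invertible in `k` for the quotient fact). For Weierstrass curves `W, W'` over a field `K` and a
prime `ℓ` with `(ℓ : K) ≠ 0`: granted (1) `nonempty_abelianVarietyBridge_symm W W'` (elliptic
curves are one-dimensional abelian varieties, both orders of the pair), (2) binary biproducts of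
abelian varieties over `K`, (3) finiteness of `K`-isomorphism classes of abelian varieties of each
dimension when `K` is finite, (4) quotient isogenies by finite `Γ_K`-stable `ℓ`-power subgroups,
(5) `#P[n](K̄) = n^{2 dim P}` for `n` invertible in `K`, and (6) the dual-isogeny fact
`Isogeny.nonempty_symm` for `(W', W)`, the named fact `isIsogenous_iff_card_point_eq W W'` holds:
for `K` finite and `W, W'` elliptic, `E ~_K E' ↔ #E(K) = #E'(K)`. Proof: the six facts give
Tate's isogeny criterion in Tate-module form at `ℓ`
(`isIsogenous_of_finite_iff_exists_tateModule_hom_ne_zero_of_named_facts`: Tate's lattice lemma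
for `E × E'`, the graph argument, transport along the bridge), and the point-count form follows
(`isIsogenous_iff_card_point_eq_of_isogenyTheorem`: Frobenius trace/determinant on `T_ℓ E`,
Cayley–Hamilton in rank two, `Γ_k = ⟨Frobenius⟩⁻`). Tate, Invent. Math. 2 (1966), §3 Thm. 1 with
§2; Silverman, *AEC*, Exercise 5.4 with Thm. III.7.7(a).
[cite: Tate1966Endomorphisms, Thm. 1] [cite: SilvermanAEC2009, Exercise 5.4] -/
theorem isIsogenous_iff_card_point_eq_of_named_facts {ℓ : ℕ} [Fact ℓ.Prime] (hℓ : (ℓ : K) ≠ 0)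
    (hbridge : nonempty_abelianVarietyBridge_symm W W')
    (hprod : ∀ A A' : AbelianVariety K, hasBinaryBiproduct A A')
    (hfin : ∀ g : ℕ, finite_isoClasses_of_finite K g)
    (hquot : ∀ P : AbelianVariety K, exists_quotient_isogeny P ℓ)
    (hcard : ∀ P : AbelianVariety K, P.natCard_torsionPoints_of_isAlgClosed (AlgebraicClosure K))
    (hsymm : Isogeny.nonempty_symm (W := W') (W' := W)) :
    isIsogenous_iff_card_point_eq W W' :=
  isIsogenous_iff_card_point_eq_of_isogenyTheorem hℓ
    (isIsogenous_of_finite_iff_exists_tateModule_hom_ne_zero_of_named_facts W W' ℓ hbridge hprod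
      hfin hquot hcard hsymm)

/-- **Tate's isogeny theorem in point-count form, from the six named facts at all primes** — the
literal shape of the eventual `isIsogenous_iff_card_point_eq_holds`: with the quotient fact
`AbelianVariety.exists_quotient_isogeny P ℓ` granted for every abelian variety `P` over `K` and
every prime `ℓ` (it is vacuous unless `(ℓ : K) ≠ 0`), a prime `ℓ ∈ {2, 3}` invertible in `K` is
chosen (`exists_prime_natCast_ne_zero`) and `isIsogenous_iff_card_point_eq_of_named_facts`
applies. Tate, Invent. Math. 2 (1966), §3 Thm. 1; Silverman, *AEC*, Exercise 5.4.
[cite: Tate1966Endomorphisms, Thm. 1] [cite: SilvermanAEC2009, Exercise 5.4] -/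
theorem isIsogenous_iff_card_point_eq_of_named_facts_forall
    (hbridge : nonempty_abelianVarietyBridge_symm W W')
    (hprod : ∀ A A' : AbelianVariety K, hasBinaryBiproduct A A')
    (hfin : ∀ g : ℕ, finite_isoClasses_of_finite K g)
    (hquot : ∀ (P : AbelianVariety K) (ℓ : ℕ), ℓ.Prime → exists_quotient_isogeny P ℓ)
    (hcard : ∀ P : AbelianVariety K, P.natCard_torsionPoints_of_isAlgClosed (AlgebraicClosure K))
    (hsymm : Isogeny.nonempty_symm (W := W') (W' := W)) :
    isIsogenous_iff_card_point_eq W W' := by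
  intro _ _ _
  obtain ⟨l, hl, hlK⟩ := exists_prime_natCast_ne_zero K
  haveI : Fact l.Prime := ⟨hl⟩
  exact isIsogenous_iff_card_point_eq_of_named_facts W W' hlK hbridge hprod hfin
    (fun P ↦ hquot P l hl) hcard hsymm

/-! ## Part 2 (appended). The dual isogeny over a finite field is a theorem: five named facts remain

`WeierstrassCurve.Isogeny.nonempty_symm` is now proved for elliptic curves over finite fields
(`WeierstrassCurve.Isogeny.nonempty_symm_holds_of_finite`,
`Literature.NumberTheory.EllipticCurves.IsogenyDualFiniteFieldProofs`: every isogeny `E → E'`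
over a finite field, separable or not, can be turned round). Since the named facts quantify
`[Finite K] [W.IsElliptic] [W'.IsElliptic]` in their bodies, hypothesis 6 disappears: what
separates the tree from `isIsogenous_iff_card_point_eq_holds` (and from
`isIsogenous_of_finite_iff_exists_tateModule_hom_ne_zero_holds`) is the theory of abelian
varieties alone — the bridge "elliptic curves are abelian varieties" and four statements about
all abelian varieties over `K` (biproducts, finiteness of isomorphism classes over a finite field,
quotient isogenies, `#P[n] = n^{2g}`). -/

/-- **Tate's isogeny criterion in Tate-module form from the abelian-variety facts only** (the
tree's `isIsogenous_of_finite_iff_exists_tateModule_hom_ne_zero_of_named_facts` with its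
dual-isogeny hypothesis discharged by `Isogeny.nonempty_symm_holds_of_finite`): for Weierstrass
curves `W, W'` over `K` and a prime `ℓ`, granted the symmetric bridge
`nonempty_abelianVarietyBridge_symm W W'` and, for all abelian varieties over `K`, binary
biproducts, finiteness of `K`-isomorphism classes in each dimension for `K` finite, quotient
isogenies by finite `Γ_K`-stable `ℓ`-power subgroups and `#P[n](K̄) = n^{2 dim P}`, the named fact
`isIsogenous_of_finite_iff_exists_tateModule_hom_ne_zero W W' ℓ` holds (Tate 1966, Thm. 1;
Silverman, *AEC*, III.7.7(a)). [cite: Tate1966Endomorphisms, Thm. 1] -/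
theorem isIsogenous_of_finite_iff_exists_tateModule_hom_ne_zero_of_abelianVariety_named_facts
    (ℓ : ℕ) [Fact ℓ.Prime]
    (hbridge : nonempty_abelianVarietyBridge_symm W W')
    (hprod : ∀ A A' : AbelianVariety K, hasBinaryBiproduct A A')
    (hfin : ∀ g : ℕ, finite_isoClasses_of_finite K g)
    (hquot : ∀ P : AbelianVariety K, exists_quotient_isogeny P ℓ)
    (hcard : ∀ P : AbelianVariety K, P.natCard_torsionPoints_of_isAlgClosed (AlgebraicClosure K)) :
    isIsogenous_of_finite_iff_exists_tateModule_hom_ne_zero W W' ℓ := by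
  intro _ _ _ hℓ
  exact isIsogenous_of_finite_iff_exists_tateModule_hom_ne_zero_of_named_facts W W' ℓ hbridge hprod
    hfin hquot hcard (Isogeny.nonempty_symm_holds_of_finite W' W) hℓ

/-- **Tate's isogeny theorem in point-count form from the abelian-variety facts only** (one prime
`ℓ` invertible in `k` for the quotient fact): `isIsogenous_iff_card_point_eq_of_named_facts` with
its sixth hypothesis, the dual isogeny for `(E', E)`, discharged by
`Isogeny.nonempty_symm_holds_of_finite`. Granted (1) `nonempty_abelianVarietyBridge_symm W W'`,
(2) binary biproducts of abelian varieties over `K`, (3) finiteness of `K`-isomorphism classes of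
abelian varieties of each dimension when `K` is finite, (4) quotient isogenies by finite
`Γ_K`-stable `ℓ`-power subgroups, (5) `#P[n](K̄) = n^{2 dim P}` for `n` invertible in `K`, the
named fact `isIsogenous_iff_card_point_eq W W'` holds: for `K` finite and `W, W'` elliptic,
`E ~_K E' ↔ #E(K) = #E'(K)`. Tate, Invent. Math. 2 (1966), §3 Thm. 1; Silverman, *AEC*,
Exercise 5.4. [cite: Tate1966Endomorphisms, Thm. 1] [cite: SilvermanAEC2009, Exercise 5.4] -/
theorem isIsogenous_iff_card_point_eq_of_abelianVariety_named_facts {ℓ : ℕ} [Fact ℓ.Prime]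
    (hℓ : (ℓ : K) ≠ 0)
    (hbridge : nonempty_abelianVarietyBridge_symm W W')
    (hprod : ∀ A A' : AbelianVariety K, hasBinaryBiproduct A A')
    (hfin : ∀ g : ℕ, finite_isoClasses_of_finite K g)
    (hquot : ∀ P : AbelianVariety K, exists_quotient_isogeny P ℓ)
    (hcard : ∀ P : AbelianVariety K, P.natCard_torsionPoints_of_isAlgClosed (AlgebraicClosure K)) :
    isIsogenous_iff_card_point_eq W W' :=
  isIsogenous_iff_card_point_eq_of_isogenyTheorem hℓ
    (isIsogenous_of_finite_iff_exists_tateModule_hom_ne_zero_of_abelianVariety_named_facts W W' ℓ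
      hbridge hprod hfin hquot hcard)

/-- **Tate's isogeny theorem in point-count form from the abelian-variety facts at all primes**
— the literal shape of the eventual `isIsogenous_iff_card_point_eq_holds` (five `_holds`
theorems of the abelian-variety library to be fed in; a prime `ℓ ∈ {2, 3}` invertible in `K` is
chosen by `exists_prime_natCast_ne_zero`). Tate, Invent. Math. 2 (1966), §3 Thm. 1; Silverman,
*AEC*, Exercise 5.4. [cite: Tate1966Endomorphisms, Thm. 1] [cite: SilvermanAEC2009, Exercise 5.4] -/
theorem isIsogenous_iff_card_point_eq_of_abelianVariety_named_facts_forall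
    (hbridge : nonempty_abelianVarietyBridge_symm W W')
    (hprod : ∀ A A' : AbelianVariety K, hasBinaryBiproduct A A')
    (hfin : ∀ g : ℕ, finite_isoClasses_of_finite K g)
    (hquot : ∀ (P : AbelianVariety K) (ℓ : ℕ), ℓ.Prime → exists_quotient_isogeny P ℓ)
    (hcard : ∀ P : AbelianVariety K, P.natCard_torsionPoints_of_isAlgClosed (AlgebraicClosure K)) :
    isIsogenous_iff_card_point_eq W W' := by
  intro _ _ _
  obtain ⟨l, hl, hlK⟩ := exists_prime_natCast_ne_zero K
  haveI : Fact l.Prime := ⟨hl⟩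
  exact isIsogenous_iff_card_point_eq_of_abelianVariety_named_facts W W' hlK hbridge hprod hfin
    (fun P ↦ hquot P l hl) hcard

/-! ## Part 3 (appended). Biproducts are a theorem and the torsion count is not needed: three named facts remain

Two of the five abelian-variety hypotheses of Part 2 are gone, by theorems of the tree:

* `AbelianVariety.hasBinaryBiproduct` is **discharged**: `Motives/AbelianVarietyProduct` makes
  `HasBinaryBiproducts (AbelianVariety K)` an instance (the fibre product `A ×_K A'` with the
  product group law is proper and geometrically integral over `K` and is a product in
  `AbelianVariety K`; `AbelianVariety.hasBinaryBiproduct_inst`, and the `_holds` form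
  `AbelianVariety.hasBinaryBiproduct_holds` of `Motives/TateAbelianFiniteStepsProofs`);
* `AbelianVariety.natCard_torsionPoints_of_isAlgClosed` (`#P[n](K̄) = n^{2 dim P}`, Mumford §6)
  served only to make `T_ℓ(A ⊞ A')` free of finite rank over `ℤ_ℓ` for the abelian surface
  `A ⊞ A' ≅ E × E'` of Tate's proof; but `T_ℓ(A ⊞ A') ≅ T_ℓ A × T_ℓ A'`
  (`AbelianVariety.exists_tateModule_linearEquiv_prod_of_bicone`), `T_ℓ A ≅ T_ℓ E` and
  `T_ℓ A' ≅ T_ℓ E'` along the bridge, and `T_ℓ E` is free of rank two (Silverman, *AEC*,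
  Prop. III.7.1, the tree's `module_free_tateModule_holds`) — this is
  `isIsogenous_of_finite_iff_exists_tateModule_hom_ne_zero_of_bridge_of_finite_of_quotient`
  (`Motives/FaltingsECTateFiniteNamedFactsProofs`), the Tate-module form of the criterion from
  three named facts, which this part feeds into the point-count form.

What separates the tree from `isIsogenous_iff_card_point_eq_holds` is now exactly:

1. `WeierstrassCurve.nonempty_abelianVarietyBridge_symm W W'` — the smooth plane cubic of an
   elliptic curve over the (perfect) finite field is a one-dimensional abelian variety whose
   non-zero homomorphisms are isogenies (*AEC* III.3.1(c), III.3.6, III.4.8–4.9), for both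
   orders of the pair;
2. `AbelianVariety.finite_isoClasses_of_finite K g` — finitely many `K`-isomorphism classes of
   `g`-dimensional abelian varieties over a finite field (Milne 1986, Cor. 18.9; used for
   `g = dim (A ⊞ A')` only);
3. `AbelianVariety.exists_quotient_isogeny P ℓ` — quotients of an abelian variety by finite
   `Γ_K`-stable `ℓ`-power subgroups with the factorisation of `[ℓⁿ]` (Mumford §7 Thm. 4; Kieffer
   2024, Prop. 1.1.10–1.1.13; used for `P = A ⊞ A'` at one prime `ℓ ≠ char K` only).
-/

/-- **Tate's isogeny theorem in point-count form from three named facts** (one prime `ℓ`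
invertible in `k` for the quotient fact): granted (1) `nonempty_abelianVarietyBridge_symm W W'`,
(2) `finite_isoClasses_of_finite K g` for all `g` (finiteness of `K`-isomorphism classes of
abelian varieties of each dimension over the finite field `K`), (3) `exists_quotient_isogeny P ℓ`
for all abelian varieties `P` over `K` (quotient isogenies by finite `Γ_K`-stable `ℓ`-power
subgroups), the named fact `isIsogenous_iff_card_point_eq W W'` holds: for `K` finite and `W, W'`
elliptic, `E ~_K E' ↔ #E(K) = #E'(K)`. The Tate-module form from the same three facts
(`isIsogenous_of_finite_iff_exists_tateModule_hom_ne_zero_of_bridge_of_finite_of_quotient`: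
Tate's lattice lemma for `A ⊞ A'`, the graph argument, transport along the bridge, the dual
isogeny over a finite field) is fed into `isIsogenous_iff_card_point_eq_of_isogenyTheorem`
(Frobenius trace and determinant on `T_ℓ E`, Cayley–Hamilton in rank two, `Γ_k = ⟨Frobenius⟩⁻`).
Tate, Invent. Math. 2 (1966), §3 Thm. 1 with §2; Silverman, *AEC*, Exercise 5.4 with
Thm. III.7.7(a). [cite: Tate1966Endomorphisms, Thm. 1] [cite: SilvermanAEC2009, Exercise 5.4] -/
theorem isIsogenous_iff_card_point_eq_of_bridge_of_finite_of_quotient {ℓ : ℕ} [Fact ℓ.Prime]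
    (hℓ : (ℓ : K) ≠ 0)
    (hbridge : nonempty_abelianVarietyBridge_symm W W')
    (hfin : ∀ g : ℕ, finite_isoClasses_of_finite K g)
    (hquot : ∀ P : AbelianVariety K, exists_quotient_isogeny P ℓ) :
    isIsogenous_iff_card_point_eq W W' :=
  isIsogenous_iff_card_point_eq_of_isogenyTheorem hℓ
    (isIsogenous_of_finite_iff_exists_tateModule_hom_ne_zero_of_bridge_of_finite_of_quotient W W' ℓ
      hbridge hfin hquot)

/-- **Tate's isogeny theorem in point-count form from three named facts at all primes** — the
literal shape of the eventual `isIsogenous_iff_card_point_eq_holds`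
(`isIsogenous_iff_card_point_eq_of_bridge_of_finite_of_quotient_forall W W'
nonempty_abelianVarietyBridge_symm_holds finite_isoClasses_of_finite_holds
exists_quotient_isogeny_holds`, once the abelian-variety library proves the three): with the
quotient fact granted at every prime (it is vacuous unless `(ℓ : K) ≠ 0`), a prime `ℓ ∈ {2, 3}`
invertible in `K` is chosen by `exists_prime_natCast_ne_zero`. Tate, Invent. Math. 2 (1966),
§3 Thm. 1; Silverman, *AEC*, Exercise 5.4.
[cite: Tate1966Endomorphisms, Thm. 1] [cite: SilvermanAEC2009, Exercise 5.4] -/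
theorem isIsogenous_iff_card_point_eq_of_bridge_of_finite_of_quotient_forall
    (hbridge : nonempty_abelianVarietyBridge_symm W W')
    (hfin : ∀ g : ℕ, finite_isoClasses_of_finite K g)
    (hquot : ∀ (P : AbelianVariety K) (ℓ : ℕ), ℓ.Prime → exists_quotient_isogeny P ℓ) :
    isIsogenous_iff_card_point_eq W W' := by
  intro _ _ _
  obtain ⟨l, hl, hlK⟩ := exists_prime_natCast_ne_zero K
  haveI : Fact l.Prime := ⟨hl⟩
  exact isIsogenous_iff_card_point_eq_of_bridge_of_finite_of_quotient W W' hlK hbridge hfin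
    (fun P ↦ hquot P l hl)

/-! ## Part 4 (appended). Elliptic curves are abelian varieties is a theorem: two named facts remain

Hypothesis 1 of Part 3, `WeierstrassCurve.nonempty_abelianVarietyBridge_symm W W'`, is
**discharged** in the tree: `WeierstrassCurve.nonempty_abelianVarietyBridge_symm_holds`
(`EllipticCurves/AbelianVarietyBridgeProofs`, through `nonempty_abelianVarietyBridgeFull_holds` of
`EllipticCurves/AbelianVarietyBridgeFullProofs`): the plane cubic `E_W ⊂ ℙ²_K` of
`EllipticCurves/WeierstrassScheme` with the addition morphism glued from the Bosma–Lenstra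
addition laws and the negation morphism is an abelian-variety model of `W`
(`EllipticCurves/AbelianVarietyModelOfAddHom`), and non-zero homomorphisms of models are
isogenies (`EllipticCurves/AbelianVarietyModelIsogeny`; Silverman, *AEC* III.3.1(c), III.3.6,
III.4.8–4.9). The sibling file `Motives/FaltingsECTateFiniteNamedFactsProofs` feeds this theorem
into the Tate-module form of the criterion
(`isIsogenous_of_finite_iff_exists_tateModule_hom_ne_zero_of_finite_of_quotient`); this part
records the point-count form. What separates the tree from `isIsogenous_iff_card_point_eq_holds`
is now exactly two statements of the theory of abelian varieties over `K`, both entering only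
through the abelian surface `A ⊞ A' ≅ E × E'` of Tate's printed proof (Invent. Math. 2 (1966), §2
and §3 Theorem 1, (b) ⇒ (a) via the Main Theorem for `E × E'`):

1. `AbelianVariety.finite_isoClasses_of_finite K g` — finitely many `K`-isomorphism classes of
   `g`-dimensional abelian varieties over the finite field `K` (Milne 1986, Cor. 18.9; used at
   `g = dim (A ⊞ A')`);
2. `AbelianVariety.exists_quotient_isogeny P ℓ` — the quotient of `P` by a finite `Γ_K`-stable
   `ℓ`-power subgroup of `P(K̄)` with the factorisation of `[ℓⁿ]` through it (Mumford §7 Thm. 4;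
   Kieffer 2024, Prop. 1.1.10–1.1.13; used at `P = A ⊞ A'` and one prime `ℓ ≠ char K`; reduced
   in `Motives/TateAbelianFiniteLatticeProofs` to the bare existence of the quotient isogeny,
   `AbelianVariety.exists_quotient_isogeny_iff_exists_isogeny_kerPoints_le`).
-/

/-- **Tate's isogeny theorem in point-count form from two named facts** (one prime `ℓ`
invertible in `k` for the quotient fact): granted (1) `finite_isoClasses_of_finite K g` for all
`g` (finiteness of `K`-isomorphism classes of abelian varieties of each dimension over the finite
field `K`; Milne 1986, Cor. 18.9) and (2) `exists_quotient_isogeny P ℓ` for all abelian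
varieties `P` over `K` (quotient isogenies by finite `Γ_K`-stable `ℓ`-power subgroups; Mumford
§7 Thm. 4), the named fact `isIsogenous_iff_card_point_eq W W'` holds: for `K` finite and
`W, W'` elliptic, `E ~_K E' ↔ #E(K) = #E'(K)`. This is
`isIsogenous_iff_card_point_eq_of_bridge_of_finite_of_quotient` with its bridge hypothesis fed
by the tree's theorem `WeierstrassCurve.nonempty_abelianVarietyBridge_symm_holds` (elliptic
curves over the perfect field `K` are abelian varieties whose non-zero homomorphisms, in both
orders of the pair, are isogenies). Tate, Invent. Math. 2 (1966), §3 Thm. 1 with §2; Silverman,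
*AEC*, Exercise 5.4 with Thm. III.7.7(a).
[cite: Tate1966Endomorphisms, Thm. 1] [cite: SilvermanAEC2009, Exercise 5.4] -/
theorem isIsogenous_iff_card_point_eq_of_finite_of_quotient {ℓ : ℕ} [Fact ℓ.Prime]
    (hℓ : (ℓ : K) ≠ 0)
    (hfin : ∀ g : ℕ, finite_isoClasses_of_finite K g)
    (hquot : ∀ P : AbelianVariety K, exists_quotient_isogeny P ℓ) :
    isIsogenous_iff_card_point_eq W W' :=
  isIsogenous_iff_card_point_eq_of_bridge_of_finite_of_quotient W W' hℓ
    (nonempty_abelianVarietyBridge_symm_holds W W') hfin hquot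

/-- **Tate's isogeny theorem in point-count form from two named facts at all primes** — the
literal shape of the eventual `isIsogenous_iff_card_point_eq_holds`
(`isIsogenous_iff_card_point_eq_of_finite_of_quotient_forall W W'
finite_isoClasses_of_finite_holds exists_quotient_isogeny_holds`, once the abelian-variety
library proves the two): with the quotient fact granted at every prime (it is vacuous unless
`(ℓ : K) ≠ 0`), a prime `ℓ ∈ {2, 3}` invertible in `K` is chosen by
`exists_prime_natCast_ne_zero` inside
`isIsogenous_iff_card_point_eq_of_bridge_of_finite_of_quotient_forall`, whose bridge hypothesis
is the theorem `WeierstrassCurve.nonempty_abelianVarietyBridge_symm_holds`. Tate, Invent. Math. 2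
(1966), §3 Thm. 1; Silverman, *AEC*, Exercise 5.4.
[cite: Tate1966Endomorphisms, Thm. 1] [cite: SilvermanAEC2009, Exercise 5.4] -/
theorem isIsogenous_iff_card_point_eq_of_finite_of_quotient_forall
    (hfin : ∀ g : ℕ, finite_isoClasses_of_finite K g)
    (hquot : ∀ (P : AbelianVariety K) (ℓ : ℕ), ℓ.Prime → exists_quotient_isogeny P ℓ) :
    isIsogenous_iff_card_point_eq W W' :=
  isIsogenous_iff_card_point_eq_of_bridge_of_finite_of_quotient_forall W W'
    (nonempty_abelianVarietyBridge_symm_holds W W') hfin hquot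

/-! ## Part 5 (appended). Quotient isogenies are a theorem: one named fact remains

Since Part 4 the quotient fact has been **proved** in the tree:
`AbelianVariety.exists_quotient_isogeny_holds P ℓ` (`Motives/TateAbelianFiniteLatticeProofs`;
the quotient of an abelian variety over a perfect field by a finite `Γ_K`-stable subgroup of its
geometric points, `Motives/AbelianVarietyQuotientGeomPoints`, with Kieffer's factorisation of
`[ℓⁿ]` through it — Mumford, *Abelian Varieties*, §7 Thm. 4; Kieffer 2024, Prop. 1.1.10 and
Prop. 1.1.12–1.1.13). The sibling file `Motives/FaltingsECTateFiniteNamedFactsProofs` (§ OneFact)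
feeds it into the Tate-module form of the criterion; this part records the point-count form.
What separates the tree from `isIsogenous_iff_card_point_eq_holds` is now exactly **one**
statement of the theory of abelian varieties over the finite field `K`, entering only through
the abelian surface `A ⊞ A' ≅ E × E'` of Tate's printed proof (Invent. Math. 2 (1966), §2 and
§3 Theorem 1, (b) ⇒ (a) via the Main Theorem for `E × E'`):

* `AbelianVariety.finite_isoClasses_of_finite K g` (all `g`; used at `g = dim (A ⊞ A')`) —
  finitely many `K`-isomorphism classes of `g`-dimensional abelian varieties over the finite
  field `K` (Milne 1986, Cor. 18.9: Zarhin's trick and the finiteness of polarised abelian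
  varieties of given degree and dimension over a finite field; Tate 1966, §2, the finiteness
  hypothesis).

Of that fact Tate's lattice argument consumes only **(∞-iso)**: in every sequence of abelian
varieties over `K` isogenous to a given one, infinitely many terms are mutually isomorphic
(finiteness of `K`-isomorphism classes *within an isogeny class*; Milne, *Abelian Varieties*
(2008), Ch. IV, Lemma 2.4, "at least one class has infinitely many `B(n)`'s"). The second theorem
records the point-count criterion from (∞-iso) alone, through the sibling file's
`isIsogenous_of_finite_iff_exists_tateModule_hom_ne_zero_of_exists_infinite_iso` (the
perfect-field lattice lemma `tateSubspaceRealization_of_exists_infinite_iso`). Neither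
hypothesis can be weakened to an input at the level of the two elliptic curves: if `E ≁_K E'`
and `#E(K) = #E'(K)`, the quotients `(A ⊞ A') / graph(gₙ)` of Tate's argument (graphs of the
`Γ_K`-isomorphisms `gₙ : E[ℓⁿ] ≅ E'[ℓⁿ]`) are pairwise non-isomorphic abelian surfaces over `K`
isogenous to `A ⊞ A'`, so the contradiction is precisely a finiteness statement for abelian
surfaces over `K`.
-/

/-- **Tate's isogeny theorem in point-count form from one named fact** — the current shape of
the eventual `isIsogenous_iff_card_point_eq_holds`
(`isIsogenous_iff_card_point_eq_of_finite_isoClasses W W' finite_isoClasses_of_finite_holds`,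
once the abelian-variety library proves the finiteness of `K`-isomorphism classes of abelian
varieties of each dimension over the finite field `K`, Milne 1986 Cor. 18.9): granted
`finite_isoClasses_of_finite K g` for all `g`, for `K` finite and `W, W'` elliptic,
`E ~_K E' ↔ #E(K) = #E'(K)`. This is `isIsogenous_iff_card_point_eq_of_finite_of_quotient_forall`
with its quotient hypothesis fed, at every prime `ℓ`, by the tree's theorem
`AbelianVariety.exists_quotient_isogeny_holds P ℓ` (quotients of abelian varieties over the
perfect field `K` by finite `Γ_K`-stable `ℓ`-power subgroups with the factorisation of `[ℓⁿ]`;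
Mumford §7 Thm. 4, Kieffer 2024 Prop. 1.1.10–1.1.13). Tate, Invent. Math. 2 (1966), §3 Thm. 1
with §2; Silverman, *AEC*, Exercise 5.4 with Thm. III.7.7(a).
[cite: Tate1966Endomorphisms, Thm. 1] [cite: SilvermanAEC2009, Exercise 5.4] -/
theorem isIsogenous_iff_card_point_eq_of_finite_isoClasses
    (hfin : ∀ g : ℕ, finite_isoClasses_of_finite K g) :
    isIsogenous_iff_card_point_eq W W' :=
  isIsogenous_iff_card_point_eq_of_finite_of_quotient_forall W W' hfin
    fun P ℓ _ ↦ exists_quotient_isogeny_holds P ℓ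

/-- **Tate's isogeny theorem in point-count form from (∞-iso)** — the hypothesis Tate's lattice
argument actually consumes: granted that in every sequence of abelian varieties over the finite
field `K` isogenous to a given one infinitely many terms are mutually isomorphic (`hiso`;
finiteness of `K`-isomorphism classes within each isogeny class — Tate 1966, §2, the finiteness
hypothesis as used; Milne, *Abelian Varieties* (2008), Ch. IV, Lemma 2.4), for `K` finite and
`W, W'` elliptic, `E ~_K E' ↔ #E(K) = #E'(K)`. A prime `ℓ ∈ {2, 3}` invertible in `K` is chosen
by `isIsogenous_iff_card_point_eq_of_isogenyTheorem_forall` (`FaltingsECCardFactsProofs`: the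
`ℓ`-adic point-count assembly, Silverman *AEC* V.2.3.1 with the Frobenius trace and determinant
on `T_ℓ E`), and at each prime the Tate-module form of the criterion is the sibling file's
`isIsogenous_of_finite_iff_exists_tateModule_hom_ne_zero_of_exists_infinite_iso`
(`FaltingsECTateFiniteNamedFactsProofs`: bridge `E, E' ↝ A, A'`, biproduct `A ⊞ A'`, quotients
by `AbelianVariety.exists_quotient_isogeny_holds`, lattice lemma
`tateSubspaceRealization_of_exists_infinite_iso`, dual isogeny over the finite field).
Tate, Invent. Math. 2 (1966), §2 and §3 Thm. 1 (b) ⇒ (a); Silverman, *AEC*, Exercise 5.4 with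
Thm. III.7.7(a). [cite: Tate1966Endomorphisms, Thm. 1] [cite: SilvermanAEC2009, Exercise 5.4] -/
theorem isIsogenous_iff_card_point_eq_of_exists_infinite_iso
    (hiso : ∀ [Finite K] (P : AbelianVariety K) (C : ℕ → AbelianVariety K),
      (∀ n, AbelianVariety.IsIsogenous (C n) P) →
        ∃ S : Set ℕ, S.Infinite ∧ ∀ m ∈ S, ∀ n ∈ S, Nonempty (C m ≅ C n)) :
    isIsogenous_iff_card_point_eq W W' :=
  isIsogenous_iff_card_point_eq_of_isogenyTheorem_forall fun ℓ _ ↦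
    isIsogenous_of_finite_iff_exists_tateModule_hom_ne_zero_of_exists_infinite_iso W W' ℓ hiso

end Literature.AlgebraicGeometry.Motives
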